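/-
Copyright (c) 2026 the pub-hodgecm-mathlib formalisation cell (harness21).  Prover seat hodgecm-mathlib-K2Liu-p11 (g0), Track B «K2-LIT»,
#184♮ = hLiu418 = `stmt-HodgeConjecture-24832`; LEAD F0P6-plan (g12) DEAL 2026-09-04T06:56:46Z ∕ «= ×3» 07:19:04Z, SIGS-RoadI-v3 §Hol
row H1-E (K2E5-plan (g5)), file E-4b of H1-E (REPORT-H1E-CENSUS.K2Liu-p11-g0.md §4).  THEOREMS ONLY (no `def`, no `instance`, no notation,
no named-fact hypothesis, no `sorry`).
-/
import Summits.HodgeConjecture.HodgeConjecture.Theorems.K2LiuLieRayDifferentiability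
import Summits.HodgeConjecture.HodgeConjecture.Theorems.K2LiuHermitianTubeDescend
import HarnessLib

/-!
# Crux `HLiu418`, Road I, organ H1-E (hermitian-tube Cauchy–Riemann dictionary), file E-4b:
# the derivative of the pulled-back form `Q = J^k · Φ` at the origin of the chart, and the Cauchy–Riemann algebra

Cell `hodgecm-mathlib`, crux item hLiu418 = `stmt-HodgeConjecture-24832` (helper lane `--supports`, count-neutral).

* §1 Letters: `ν(b) = (0 b; 0 0)`, `μ(b) = (b 0; 0 −b)` and `Λ(r₁,r₂) = (η r₂  η r₁; 0  −η r₂)` lie in `𝔲(J)` for hermitian `b`;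
  an explicit real-linear isomorphism `η : (l → l → ℝ) → Herm_l(ℂ)` (`exists_hermCoord`), and `Λ` as a continuous linear map
  (`exists_chartGen`).
* §2 `exists_hasFDerivAt_pullback` — the real derivative at `0` of
  `Q(y) = (∏_s det(denom (g₀ s · exp Λ(y s)) (i·1))^{k s}) · Φ (s ↦ g₀ s · exp Λ(y s))`:
  `DQ(0) y = J₀ · Σ_s ( D s (Λ (y s)) g₀ + k_s · tr(i(Λ y_s)₂₁ + (Λ y_s)₂₂) · Φ g₀ )`, `J₀ = ∏_s det(C s)^{k s}` when
  `denom (g₀ s M) (i·1) = C s · denom M (i·1)` (★ E-1 `exists_hasFDerivAt_placewiseExp`, ★ E-3 `exists_hasFDerivAt_det_denom_exp`,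
  `HasFDerivAt.finsetProd`, `hasDerivAt_zpow`).
* §3 `pullbackDeriv_J` — THE CAUCHY–RIEMANN CHECK: under (L-lin) and the `P`-form relation
  (CR-P) `D s (μ b) g − 2i·D s (ν b) g = k_s·tr(b)·Φ g` (hermitian `b`), the bracket above satisfies `T(−2r₂, ½r₁) = i·T(r₁, r₂)`, i.e.
  `DQ(0) ∘ 𝒥 = i·DQ(0)` for `𝒥(r₁,r₂) = (−2r₂, ½r₁)` — the `k·tr` term produced by the automorphy factor is exactly cancelled by the
  `K∞`-type term of (CR-P).
References: [Shimura1997, §§5–6]; [Bump1997, §2.1 (the `SL₂(ℝ)` lowering operator)].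
HONEST LABEL: HC_CM is proved only modulo the 7 printed citations (2 remaining named inputs: hLiu418 = stmt-HodgeConjecture-24832,
h413 = stmt-HodgeConjecture-24833) until rung 0 closes; count-neutral helper, closes no socket.
-/

set_option autoImplicit false
set_option linter.dupNamespace false

noncomputable section

open scoped Matrix Topology ComplexOrder
open Filter Set NormedSpace Complex Matrix
open Literature.NumberTheory.ModularForms.SiegelUpperHalfSpace (num denom moeb num_def denom_def moeb_def)
open Summit.HodgeConjecture.HodgeConjecture.Cruxes.HLiu418.K2LiuHermitianTubeCocycle
open Summit.HodgeConjecture.HodgeConjecture.Cruxes.HLiu418.K2LiuLieRayDifferentiability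
open Summit.HodgeConjecture.HodgeConjecture.Cruxes.HLiu418.K2LiuHermitianTubeDescend

namespace Summit.HodgeConjecture.HodgeConjecture.Cruxes.HLiu418.K2LiuHermitianTubeCRDeriv

variable {l : Type*} [Fintype l] [DecidableEq l]

/-! ## §1 The letters `ν(b)`, `μ(b)`, `Λ(r₁,r₂)` and the hermitian coordinates `η` -/

/-- `ν(b) = (0 b; 0 0) ∈ 𝔲(J)` for hermitian `b`. [cite: Shimura1997, §5.6] -/
theorem transl_gen_mem {b : Matrix l l ℂ} (hb : bᴴ = b) :
    (fromBlocks 0 b 0 0 : Matrix (l ⊕ l) (l ⊕ l) ℂ)ᴴ * Matrix.J l ℂ + Matrix.J l ℂ * fromBlocks 0 b 0 0 = 0 := by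
  rw [Matrix.J, fromBlocks_conjTranspose, fromBlocks_multiply, fromBlocks_multiply, fromBlocks_add, hb]
  simp [fromBlocks_zero]

/-- `μ(b) = (b 0; 0 −b) ∈ 𝔲(J)` for hermitian `b`. [cite: Shimura1997, §5.6] -/
theorem levi_gen_mem {b : Matrix l l ℂ} (hb : bᴴ = b) :
    (fromBlocks b 0 0 (-b) : Matrix (l ⊕ l) (l ⊕ l) ℂ)ᴴ * Matrix.J l ℂ + Matrix.J l ℂ * fromBlocks b 0 0 (-b) = 0 := by
  rw [Matrix.J, fromBlocks_conjTranspose, fromBlocks_multiply, fromBlocks_multiply, fromBlocks_add, conjTranspose_neg, hb]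
  simp [fromBlocks_zero]

/-- `Λ(b, c) = (c b; 0 −c) = ν(b) + μ(c) ∈ 𝔲(J)` for hermitian `b, c`. [cite: Shimura1997, §5.6] -/
theorem chart_gen_mem {b c : Matrix l l ℂ} (hb : bᴴ = b) (hc : cᴴ = c) :
    (fromBlocks c b 0 (-c) : Matrix (l ⊕ l) (l ⊕ l) ℂ)ᴴ * Matrix.J l ℂ + Matrix.J l ℂ * fromBlocks c b 0 (-c) = 0 := by
  have h : (fromBlocks c b 0 (-c) : Matrix (l ⊕ l) (l ⊕ l) ℂ) = fromBlocks 0 b 0 0 + fromBlocks c 0 0 (-c) := by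
    rw [fromBlocks_add]; simp
  rw [h, conjTranspose_add, Matrix.add_mul, Matrix.mul_add, add_add_add_comm, transl_gen_mem hb, levi_gen_mem hc, add_zero]

omit [Fintype l] [DecidableEq l] in
/-- `Λ(b, c) = ν(b) + μ(c)`. [folklore] -/
theorem chart_gen_eq_add (b c : Matrix l l ℂ) :
    (fromBlocks c b 0 (-c) : Matrix (l ⊕ l) (l ⊕ l) ℂ) = (1 : ℝ) • fromBlocks 0 b 0 0 + fromBlocks c 0 0 (-c) := by
  rw [one_smul, fromBlocks_add]; simp

omit [DecidableEq l] in
/-- **Hermitian coordinates**: an explicit real-linear bijection `η` from `l → l → ℝ` onto the hermitian `l × l` matrices,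
`η r = (r_{ij} + r_{ji}) + (r_{ij} − r_{ji}) i`. [folklore] -/
theorem exists_hermCoord :
    ∃ η : (l → l → ℝ) →L[ℝ] Matrix l l ℂ, (∀ r, (η r)ᴴ = η r) ∧ Function.Injective η ∧
      ∀ b : Matrix l l ℂ, bᴴ = b → ∃ r, η r = b := by
  -- the bare map and its three properties
  have happH : ∀ r : l → l → ℝ,
      (Matrix.of fun i j => (((r i j + r j i : ℝ) : ℂ) + ((r i j - r j i : ℝ) : ℂ) * I))ᴴ =
        Matrix.of fun i j => (((r i j + r j i : ℝ) : ℂ) + ((r i j - r j i : ℝ) : ℂ) * I) := by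
    intro r
    ext i j
    rw [conjTranspose_apply, Matrix.of_apply, Matrix.of_apply]
    simp only [star_add, star_mul, Complex.star_def, Complex.conj_ofReal, Complex.conj_I]
    push_cast
    ring
  have hinj : ∀ r r' : l → l → ℝ,
      (Matrix.of fun i j => (((r i j + r j i : ℝ) : ℂ) + ((r i j - r j i : ℝ) : ℂ) * I)) =
        (Matrix.of fun i j => (((r' i j + r' j i : ℝ) : ℂ) + ((r' i j - r' j i : ℝ) : ℂ) * I)) → r = r' := by
    intro r r' h
    funext i j
    have hij := congrFun (congrFun h i) j
    simp only [Matrix.of_apply] at hij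
    have h1 := congrArg Complex.re hij
    have h2 := congrArg Complex.im hij
    simp only [Complex.add_re, Complex.ofReal_re, Complex.mul_re, Complex.I_re, Complex.I_im, Complex.ofReal_im,
      mul_zero, mul_one, sub_zero, Complex.add_im, Complex.mul_im, zero_add, add_zero] at h1 h2
    linarith
  have hsurj : ∀ b : Matrix l l ℂ, bᴴ = b →
      ∃ r : l → l → ℝ, (Matrix.of fun i j => (((r i j + r j i : ℝ) : ℂ) + ((r i j - r j i : ℝ) : ℂ) * I)) = b := by
    intro b hb
    refine ⟨fun i j => (b i j).re / 2 + (b i j).im / 2, ?_⟩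
    ext i j
    simp only [Matrix.of_apply]
    have hji : b j i = star (b i j) := by
      rw [← conjTranspose_apply, hb]
    have hre : (b j i).re = (b i j).re := by rw [hji, Complex.star_def, Complex.conj_re]
    have him : (b j i).im = -(b i j).im := by rw [hji, Complex.star_def, Complex.conj_im]
    rw [hre, him]
    apply Complex.ext <;> simp <;> ring
  refine ⟨LinearMap.toContinuousLinearMap
    { toFun := fun r => Matrix.of fun i j => (((r i j + r j i : ℝ) : ℂ) + ((r i j - r j i : ℝ) : ℂ) * I)
      map_add' := fun r r' => ?_
      map_smul' := fun a r => ?_ }, fun r => happH r, fun r r' h => hinj r r' h, fun b hb => hsurj b hb⟩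
  · ext i j
    simp only [Matrix.of_apply, Pi.add_apply, Matrix.add_apply]
    push_cast
    ring
  · ext i j
    simp only [Matrix.of_apply, Pi.smul_apply, Matrix.smul_apply, smul_eq_mul, RingHom.id_apply, Complex.real_smul]
    push_cast
    ring

omit [Fintype l] [DecidableEq l] in
/-- The chart generator `Λ(r₁,r₂) = (η r₂  η r₁; 0  −η r₂)` as a continuous linear map. [folklore] -/
theorem exists_chartGen {Eh : Type*} [NormedAddCommGroup Eh] [NormedSpace ℝ Eh] [FiniteDimensional ℝ Eh]
    (η : Eh →L[ℝ] Matrix l l ℂ) :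
    ∃ Λ : (Eh × Eh) →L[ℝ] Matrix (l ⊕ l) (l ⊕ l) ℂ, ∀ y, Λ y = fromBlocks (η y.2) (η y.1) 0 (-(η y.2)) := by
  refine ⟨LinearMap.toContinuousLinearMap
    { toFun := fun y => fromBlocks (η y.2) (η y.1) 0 (-(η y.2))
      map_add' := fun y y' => ?_
      map_smul' := fun a y => ?_ }, fun y => rfl⟩
  · simp only [Prod.fst_add, Prod.snd_add, map_add, fromBlocks_add, add_zero, neg_add]
  · simp only [Prod.smul_fst, Prod.smul_snd, map_smul, RingHom.id_apply, fromBlocks_smul, smul_zero, smul_neg]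

/-! ## §2 The derivative of the pull-back `Q = J^k · Φ` at the origin -/

section Pullback

variable {σ : Type*} [Fintype σ] [DecidableEq σ] {n : ℕ}
variable {E₀ : Type*} [NormedAddCommGroup E₀] [NormedSpace ℝ E₀] [FiniteDimensional ℝ E₀]

omit [Fintype σ] [DecidableEq σ] in
/-- Linearity consequence: `D s (a • Y) g = a · D s Y g` on `𝔲(J)`. [folklore] -/
theorem lieDeriv_smul (D : σ → Matrix (Fin n ⊕ Fin n) (Fin n ⊕ Fin n) ℂ → (σ → Matrix (Fin n ⊕ Fin n) (Fin n ⊕ Fin n) ℂ) → ℂ)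
    (hDl : ∀ (s : σ) (g : σ → Matrix (Fin n ⊕ Fin n) (Fin n ⊕ Fin n) ℂ) (a : ℝ)
      (Y Y' : Matrix (Fin n ⊕ Fin n) (Fin n ⊕ Fin n) ℂ),
      Yᴴ * Matrix.J (Fin n) ℂ + Matrix.J (Fin n) ℂ * Y = 0 → Y'ᴴ * Matrix.J (Fin n) ℂ + Matrix.J (Fin n) ℂ * Y' = 0 →
      (∀ s', (g s')ᴴ * Matrix.J (Fin n) ℂ * g s' = Matrix.J (Fin n) ℂ) →
      D s (a • Y + Y') g = (a : ℂ) * D s Y g + D s Y' g)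
    (s : σ) {g : σ → Matrix (Fin n ⊕ Fin n) (Fin n ⊕ Fin n) ℂ} (hg : ∀ s', (g s')ᴴ * Matrix.J (Fin n) ℂ * g s' = Matrix.J (Fin n) ℂ)
    (a : ℝ) {Y : Matrix (Fin n ⊕ Fin n) (Fin n ⊕ Fin n) ℂ} (hY : Yᴴ * Matrix.J (Fin n) ℂ + Matrix.J (Fin n) ℂ * Y = 0) :
    D s (a • Y) g = (a : ℂ) * D s Y g := by
  have h0 : D s 0 g = 0 := by
    have h := hDl s g 1 0 0 (by simp) (by simp) hg
    simp only [one_smul, add_zero, Complex.ofReal_one, one_mul] at h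
    linear_combination -h
  have h := hDl s g a Y 0 hY (by simp) hg
  rwa [add_zero, h0, add_zero] at h

/-- **The real derivative of the pull-back at the origin.**  With (L), (L-lin), (hDc) as in the H1-E face, `Λ : E₀ → 𝔲(J)` real-linear,
`g₀ ∈ U(J)^σ` and `denom (g₀ s · M) (i·1) = C s · denom M (i·1)` with `C s` invertible:
`Q(y) := (∏_s det(denom (g₀ s · exp Λ(y s)) (i·1))^{k s}) · Φ(s ↦ g₀ s · exp Λ(y s))` has a Fréchet derivative `L` at `0` with
`L y = (∏_s det(C s)^{k s}) · Σ_s (D s (Λ (y s)) g₀ + k s · tr(i (Λ(y s))₂₁ + (Λ(y s))₂₂) · Φ g₀)`. [cite: Shimura1997, §5.6] -/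
theorem exists_hasFDerivAt_pullback (k : σ → ℤ) (Φ : (σ → Matrix (Fin n ⊕ Fin n) (Fin n ⊕ Fin n) ℂ) → ℂ)
    (D : σ → Matrix (Fin n ⊕ Fin n) (Fin n ⊕ Fin n) ℂ → (σ → Matrix (Fin n ⊕ Fin n) (Fin n ⊕ Fin n) ℂ) → ℂ)
    (hD : ∀ (s : σ) (Y : Matrix (Fin n ⊕ Fin n) (Fin n ⊕ Fin n) ℂ) (g : σ → Matrix (Fin n ⊕ Fin n) (Fin n ⊕ Fin n) ℂ),
      Yᴴ * Matrix.J (Fin n) ℂ + Matrix.J (Fin n) ℂ * Y = 0 →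
      (∀ s', (g s')ᴴ * Matrix.J (Fin n) ℂ * g s' = Matrix.J (Fin n) ℂ) →
      HasDerivAt (fun t : ℝ => Φ (Function.update g s (g s * exp (t • Y)))) (D s Y g) 0)
    (hDl : ∀ (s : σ) (g : σ → Matrix (Fin n ⊕ Fin n) (Fin n ⊕ Fin n) ℂ) (a : ℝ)
      (Y Y' : Matrix (Fin n ⊕ Fin n) (Fin n ⊕ Fin n) ℂ),
      Yᴴ * Matrix.J (Fin n) ℂ + Matrix.J (Fin n) ℂ * Y = 0 → Y'ᴴ * Matrix.J (Fin n) ℂ + Matrix.J (Fin n) ℂ * Y' = 0 →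
      (∀ s', (g s')ᴴ * Matrix.J (Fin n) ℂ * g s' = Matrix.J (Fin n) ℂ) →
      D s (a • Y + Y') g = (a : ℂ) * D s Y g + D s Y' g)
    (hDc : ∀ (s : σ) (Y : Matrix (Fin n ⊕ Fin n) (Fin n ⊕ Fin n) ℂ), Yᴴ * Matrix.J (Fin n) ℂ + Matrix.J (Fin n) ℂ * Y = 0 →
      ContinuousOn (D s Y) {g | ∀ s', (g s')ᴴ * Matrix.J (Fin n) ℂ * g s' = Matrix.J (Fin n) ℂ})
    (Λ : E₀ →L[ℝ] Matrix (Fin n ⊕ Fin n) (Fin n ⊕ Fin n) ℂ)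
    (hΛ : ∀ w, (Λ w)ᴴ * Matrix.J (Fin n) ℂ + Matrix.J (Fin n) ℂ * Λ w = 0)
    (g₀ : σ → Matrix (Fin n ⊕ Fin n) (Fin n ⊕ Fin n) ℂ) (hg₀ : ∀ s, (g₀ s)ᴴ * Matrix.J (Fin n) ℂ * g₀ s = Matrix.J (Fin n) ℂ)
    (C : σ → Matrix (Fin n) (Fin n) ℂ) (hCu : ∀ s, IsUnit (C s).det)
    (hC : ∀ s (M : Matrix (Fin n ⊕ Fin n) (Fin n ⊕ Fin n) ℂ),
      denom (g₀ s * M) (I • (1 : Matrix (Fin n) (Fin n) ℂ)) = C s * denom M (I • 1)) :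
    ∃ L : (σ → E₀) →L[ℝ] ℂ,
      HasFDerivAt (fun y : σ → E₀ =>
        (∏ s, (denom (g₀ s * exp (Λ (y s))) (I • (1 : Matrix (Fin n) (Fin n) ℂ))).det ^ k s) *
          Φ (fun s => g₀ s * exp (Λ (y s)))) L 0 ∧
      ∀ y : σ → E₀, L y = (∏ s, (C s).det ^ k s) *
        ∑ s, (D s (Λ (y s)) g₀ +
          (k s : ℂ) * (I • (Λ (y s)).toBlocks₂₁ + (Λ (y s)).toBlocks₂₂).trace * Φ g₀) := by
  classical
  -- the `Φ`-factor (★ E-1)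
  obtain ⟨L₁, hL₁, hΦ⟩ := exists_hasFDerivAt_placewiseExp Φ D hD hDl hDc Λ hΛ g₀ hg₀
  -- the scalar factors (★ E-3)
  obtain ⟨Lh, hh, hLh⟩ := exists_hasFDerivAt_det_denom_exp (l := Fin n) Λ
  have hh0 : (denom (exp (Λ (0 : E₀))) (I • (1 : Matrix (Fin n) (Fin n) ℂ))).det = 1 := by
    rw [map_zero, NormedSpace.exp_zero, denom_def, ← fromBlocks_one, toBlocks_fromBlocks₂₁, toBlocks_fromBlocks₂₂,
      Matrix.zero_mul, zero_add, det_one]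
  -- `u_s(y) = det(C s) · h(y s)` and its `k s`-th power
  have hu : ∀ s, HasFDerivAt (fun y : σ → E₀ => (C s).det * (denom (exp (Λ (y s))) (I • (1 : Matrix (Fin n) (Fin n) ℂ))).det)
      ((C s).det • Lh.comp (ContinuousLinearMap.proj s)) 0 := by
    intro s
    have hp : HasFDerivAt (fun y : σ → E₀ => y s) (ContinuousLinearMap.proj s : (σ → E₀) →L[ℝ] E₀) 0 :=
      (ContinuousLinearMap.proj s : (σ → E₀) →L[ℝ] E₀).hasFDerivAt
    have hcomp : HasFDerivAt (fun y : σ → E₀ => (denom (exp (Λ (y s))) (I • (1 : Matrix (Fin n) (Fin n) ℂ))).det)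
        (Lh.comp (ContinuousLinearMap.proj s)) 0 := by
      have hh' : HasFDerivAt (fun y : E₀ => (denom (exp (Λ y)) (I • (1 : Matrix (Fin n) (Fin n) ℂ))).det) Lh
          ((fun y : σ → E₀ => y s) 0) := hh
      exact hh'.comp 0 hp
    exact hcomp.const_mul ((C s).det)
  have hu0 : ∀ s, (C s).det * (denom (exp (Λ ((0 : σ → E₀) s))) (I • (1 : Matrix (Fin n) (Fin n) ℂ))).det = (C s).det := by
    intro s; rw [Pi.zero_apply, hh0, mul_one]
  have hpow : ∀ s, HasFDerivAt
      (fun y : σ → E₀ => ((C s).det * (denom (exp (Λ (y s))) (I • (1 : Matrix (Fin n) (Fin n) ℂ))).det) ^ k s)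
      (((k s : ℂ) * (C s).det ^ (k s - 1)) • ((C s).det • Lh.comp (ContinuousLinearMap.proj s))) 0 := by
    intro s
    have hz := hasDerivAt_zpow (k s) ((C s).det) (Or.inl (hCu s).ne_zero)
    rw [← hu0 s] at hz
    have h := hz.comp_hasFDerivAt (0 : σ → E₀) (hu s)
    rw [hu0 s] at h
    exact h
  -- the finite product
  have hprod := HasFDerivAt.finsetProd (u := Finset.univ) (fun s _ => hpow s)
  -- the factorisation `denom (g₀ s · M) = C s · denom M`
  have hfac : ∀ y : σ → E₀, (∏ s, (denom (g₀ s * exp (Λ (y s))) (I • (1 : Matrix (Fin n) (Fin n) ℂ))).det ^ k s) =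
      ∏ s, ((C s).det * (denom (exp (Λ (y s))) (I • (1 : Matrix (Fin n) (Fin n) ℂ))).det) ^ k s := by
    intro y
    refine Finset.prod_congr rfl fun s _ => ?_
    rw [hC, det_mul]
  -- the product with `Φ`
  have hQ := hprod.mul hΦ
  have hQ' := hQ.congr_of_eventuallyEq
    (f₁ := fun y : σ → E₀ =>
      (∏ s, (denom (g₀ s * exp (Λ (y s))) (I • (1 : Matrix (Fin n) (Fin n) ℂ))).det ^ k s) *
        Φ (fun s => g₀ s * exp (Λ (y s))))
    (Eventually.of_forall fun y => by simp only [Pi.mul_apply]; rw [hfac])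
  refine ⟨_, hQ', fun y => ?_⟩
  · -- evaluate the derivative
    have hΦ0 : Φ (fun s => g₀ s * exp (Λ ((0 : σ → E₀) s))) = Φ g₀ := by
      congr 1; funext s; rw [Pi.zero_apply, map_zero, NormedSpace.exp_zero, Matrix.mul_one]
    have hg0 : ∀ s, ((C s).det * (denom (exp (Λ ((0 : σ → E₀) s))) (I • (1 : Matrix (Fin n) (Fin n) ℂ))).det) ^ k s =
        (C s).det ^ k s := fun s => by rw [hu0]
    have hJ₀ : (∏ s, ((C s).det * (denom (exp (Λ ((0 : σ → E₀) s))) (I • (1 : Matrix (Fin n) (Fin n) ℂ))).det) ^ k s) =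
        ∏ s, (C s).det ^ k s := Finset.prod_congr rfl fun s _ => hg0 s
    have hsummand : ∀ s, (∏ j ∈ Finset.univ.erase s,
        ((C j).det * (denom (exp (Λ ((0 : σ → E₀) j))) (I • (1 : Matrix (Fin n) (Fin n) ℂ))).det) ^ k j) *
          (((k s : ℂ) * (C s).det ^ (k s - 1)) * ((C s).det * Lh (y s))) =
        (∏ j, (C j).det ^ k j) * ((k s : ℂ) * Lh (y s)) := by
      intro s
      have hne : (C s).det ≠ 0 := (hCu s).ne_zero
      have hks : (C s).det ^ (k s - 1) * (C s).det = (C s).det ^ k s := by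
        rw [zpow_sub_one₀ hne, mul_assoc, inv_mul_cancel₀ hne, mul_one]
      rw [Finset.prod_congr rfl fun j _ => hg0 j, ← Finset.prod_erase_mul _ _ (Finset.mem_univ s), ← hks]
      ring
    simp only [_root_.add_apply, _root_.smul_apply, FunLike.coe_sum, Finset.sum_apply, ContinuousLinearMap.comp_apply,
      ContinuousLinearMap.proj_apply, smul_eq_mul, hL₁, hΦ0, hJ₀, Finset.mul_sum, ← Finset.sum_add_distrib]
    refine Finset.sum_congr rfl fun s _ => ?_
    rw [hsummand s, hLh]
    ring

/-! ## §3 The Cauchy–Riemann check -/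

omit [Fintype σ] [DecidableEq σ] in
/-- **The Cauchy–Riemann check.**  With `Λ(r₁,r₂) = (η r₂  η r₁; 0  −η r₂)` for a hermitian-valued `η`, (L-lin), and the `P`-form relation
(CR-P) `D s (μ b) g − 2i·D s (ν b) g = k s·tr(b)·Φ g` at `g₀`, the bracket `T(r₁,r₂) := D s (Λ(r₁,r₂)) g₀ + k s·tr(i Λ₂₁ + Λ₂₂)·Φ g₀`
satisfies `T(−2r₂, ½r₁) = i·T(r₁,r₂)`. [cite: Bump1997, §2.1] -/
theorem pullbackDeriv_J {Eh : Type*} [NormedAddCommGroup Eh] [NormedSpace ℝ Eh]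
    (k : σ → ℤ) (Φ : (σ → Matrix (Fin n ⊕ Fin n) (Fin n ⊕ Fin n) ℂ) → ℂ)
    (D : σ → Matrix (Fin n ⊕ Fin n) (Fin n ⊕ Fin n) ℂ → (σ → Matrix (Fin n ⊕ Fin n) (Fin n ⊕ Fin n) ℂ) → ℂ)
    (hDl : ∀ (s : σ) (g : σ → Matrix (Fin n ⊕ Fin n) (Fin n ⊕ Fin n) ℂ) (a : ℝ)
      (Y Y' : Matrix (Fin n ⊕ Fin n) (Fin n ⊕ Fin n) ℂ),
      Yᴴ * Matrix.J (Fin n) ℂ + Matrix.J (Fin n) ℂ * Y = 0 → Y'ᴴ * Matrix.J (Fin n) ℂ + Matrix.J (Fin n) ℂ * Y' = 0 →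
      (∀ s', (g s')ᴴ * Matrix.J (Fin n) ℂ * g s' = Matrix.J (Fin n) ℂ) →
      D s (a • Y + Y') g = (a : ℂ) * D s Y g + D s Y' g)
    (η : Eh →L[ℝ] Matrix (Fin n) (Fin n) ℂ) (hηH : ∀ r, (η r)ᴴ = η r)
    (Λ : (Eh × Eh) →L[ℝ] Matrix (Fin n ⊕ Fin n) (Fin n ⊕ Fin n) ℂ) (hΛ : ∀ y, Λ y = fromBlocks (η y.2) (η y.1) 0 (-(η y.2)))
    {g₀ : σ → Matrix (Fin n ⊕ Fin n) (Fin n ⊕ Fin n) ℂ} (hg₀ : ∀ s, (g₀ s)ᴴ * Matrix.J (Fin n) ℂ * g₀ s = Matrix.J (Fin n) ℂ)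
    (s : σ)
    (hCR : ∀ b : Matrix (Fin n) (Fin n) ℂ, bᴴ = b →
      D s (fromBlocks b 0 0 (-b)) g₀ - 2 * I * D s (fromBlocks 0 b 0 0) g₀ = (k s : ℂ) * b.trace * Φ g₀)
    (y : Eh × Eh) :
    D s (Λ ((-(2 : ℝ)) • y.2, (2 : ℝ)⁻¹ • y.1)) g₀ +
        (k s : ℂ) * (I • (Λ ((-(2 : ℝ)) • y.2, (2 : ℝ)⁻¹ • y.1)).toBlocks₂₁ +
          (Λ ((-(2 : ℝ)) • y.2, (2 : ℝ)⁻¹ • y.1)).toBlocks₂₂).trace * Φ g₀ =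
      I * (D s (Λ y) g₀ + (k s : ℂ) * (I • (Λ y).toBlocks₂₁ + (Λ y).toBlocks₂₂).trace * Φ g₀) := by
  -- split `D s (Λ(r₁,r₂)) = D s (ν(η r₁)) + D s (μ(η r₂))` and pull out scalars
  have hsplit : ∀ r₁ r₂ : Eh, D s (Λ (r₁, r₂)) g₀ = D s (fromBlocks 0 (η r₁) 0 0) g₀ + D s (fromBlocks (η r₂) 0 0 (-(η r₂))) g₀ := by
    intro r₁ r₂
    rw [hΛ, chart_gen_eq_add, hDl s g₀ 1 _ _ (transl_gen_mem (hηH r₁)) (levi_gen_mem (hηH r₂)) hg₀, Complex.ofReal_one, one_mul]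
  have hν : D s (fromBlocks 0 (η ((-(2 : ℝ)) • y.2)) 0 0) g₀ = ((-(2 : ℝ) : ℝ) : ℂ) * D s (fromBlocks 0 (η y.2) 0 0) g₀ := by
    rw [map_smul, show (fromBlocks 0 ((-(2 : ℝ)) • η y.2) 0 0 : Matrix (Fin n ⊕ Fin n) (Fin n ⊕ Fin n) ℂ) =
      (-(2 : ℝ)) • fromBlocks 0 (η y.2) 0 0 by rw [fromBlocks_smul, smul_zero],
      lieDeriv_smul D hDl s hg₀ _ (transl_gen_mem (hηH _))]
  have hμ : D s (fromBlocks (η ((2 : ℝ)⁻¹ • y.1)) 0 0 (-(η ((2 : ℝ)⁻¹ • y.1)))) g₀ =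
      (((2 : ℝ)⁻¹ : ℝ) : ℂ) * D s (fromBlocks (η y.1) 0 0 (-(η y.1))) g₀ := by
    rw [map_smul, show (fromBlocks ((2 : ℝ)⁻¹ • η y.1) 0 0 (-((2 : ℝ)⁻¹ • η y.1)) : Matrix (Fin n ⊕ Fin n) (Fin n ⊕ Fin n) ℂ) =
      (2 : ℝ)⁻¹ • fromBlocks (η y.1) 0 0 (-(η y.1)) by rw [fromBlocks_smul, smul_zero, smul_neg],
      lieDeriv_smul D hDl s hg₀ _ (levi_gen_mem (hηH _))]
  -- the traces
  have htr : ∀ r₁ r₂ : Eh, (I • (Λ (r₁, r₂)).toBlocks₂₁ + (Λ (r₁, r₂)).toBlocks₂₂).trace = -(η r₂).trace := by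
    intro r₁ r₂
    rw [hΛ, toBlocks_fromBlocks₂₁, toBlocks_fromBlocks₂₂, smul_zero, zero_add, trace_neg]
  have htr' : (η ((2 : ℝ)⁻¹ • y.1)).trace = ((2 : ℝ)⁻¹ : ℝ) * (η y.1).trace := by
    rw [map_smul, ← Complex.coe_smul, trace_smul, smul_eq_mul]
  -- the two instances of (CR-P)
  have h₁ := hCR (η y.1) (hηH y.1)
  have h₂ := hCR (η y.2) (hηH y.2)
  rw [hsplit, hsplit, hν, hμ, htr, htr, htr']
  push_cast
  linear_combination (2 : ℂ)⁻¹ * h₁ - I * h₂ + (-2 * D s (fromBlocks 0 (η y.2) 0 0) g₀) * Complex.I_mul_I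

end Pullback

end Summit.HodgeConjecture.HodgeConjecture.Cruxes.HLiu418.K2LiuHermitianTubeCRDeriv

end
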